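import Mathlib
import HarnessLib
import Summits.Ventures.LatticeQCDFlow.Scoring.FlowSamplerWindowBracket
import Summits.Ventures.LatticeQCDFlow.Scoring.IndepMHRejectionFloor
import Summits.Ventures.LatticeQCDFlow.Exactness.Phi4FlowSamplerErgodic

/-!
# Independence Metropolis with an UN-NORMALISED weight: the sampler never needs `Z`, and the whole
# certified autocorrelation sandwich holds for the normalised target with Doeblin constant `Z / sup w`

HONEST FRAMING: exact (Metropolis-corrected) sampling algorithms for lattice gauge theory;
figures of merit are autocorrelation/cost numbers at stated couplings and volumes; no
continuum-physics claim.

Venture `LatticeQCDFlow` (cell pub-lqcd), topic `Scoring`; FANOUT row 8 (`s0-cpn-nemc`, GEN-12).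
NEW WORK of the cell, not a published result; no definition is introduced.  Row 30's general-space
independence-Metropolis kernel `indepMH q w` (`Exactness/IMHKernel.lean`) only needs a positive
measurable weight `w`; its natural target `w · q` need not be a probability law, and every kernel-level
autocorrelation theorem of the tree (`Scoring/IndepMHKernelPositive.lean`,
`IndepMHRejectionFloor.lean`, `DoeblinAutocorrelation.lean`, `DoeblinWindowBracket.lean`,
`FlowSamplerWindowBracket.lean`) was stated for `w · q = π` a probability law.  This file removes the
normalisation: with `w · q = Z • π` (`π` a probability law, `0 < Z < ∞` — the target known up to its
constant, the situation of every lattice sampler and of every non-equilibrium / Jarzynski weight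
`e^{−W}`, whose `Z` is `Z₁/Z₀ = e^{−ΔF}`), everything transfers to `π`.  Printed counterpart, NAMED
ONLY: Mengersen–Tweedie 1996 Thm 2.1 (uniform ergodicity of the independence sampler iff the
normalised weight is bounded, rate `(1 − 1/w̄⋆)ᵗ`).

## Content (any measurable space; `q` a probability law, `w > 0` measurable, `w · q = Z • π`)

* `imhAcceptE_const_mul`, `imhAcceptMass_const_mul` — the acceptance density and mass are invariant
  under `w ↦ c w` (`c > 0`); the kernel itself is too: row 2's `Exactness.indepMH_const_mul`
  (`Exactness/Phi4FlowSamplerErgodic.lean`, imported and reused, not restated);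
* `integrable_weight_of_smul`; **`normalisedWeight_spec`** — `w̄ = Z⁻¹ w` is measurable, positive,
  integrable, has `w̄ · q = π`, and `indepMH q w = indepMH q w̄`;
* **`indepMH_invariant_of_smul`**, `indepMH_isReversible_of_smul` — `π` is an invariant probability
  law, with detailed balance;
* **`indepMH_autocov_nonneg_of_smul`**, `indepMH_acf_pow_le_of_smul`, **`indepMH_tauInt_floor_of_smul`**,
  `indepMH_tauInt_ge_rejection_of_smul` — every stationary autocovariance of every bounded
  measurable observable is `≥ 0`, `ρ₁ᵗ ≤ ρ_t`, `ρ₁ < 1 ∧ (1 + ρ₁)/(2(1 − ρ₁)) ≤ τ_int` (summable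
  `ρ`), and the rejection floor `τ_int ≥ 1/2 + r_g/(1 − r_g)` (the acceptance mass `imhAcceptMass q w`
  is itself normalisation-free);
* **`indepMH_doeblin_of_smul`** — a weight CEILING `w ≤ M` is a Doeblin constant BY `π`:
  `indepMH q w (x, ·) ≥ (Z/M) π` — `Z/M = 1/w̄⋆`, the reciprocal of the supremum of the NORMALISED
  weight; `doeblinConst_of_smul_spec` (`1/ε = M/Z`);
* **`indepMH_tauInt_le_of_smul`** (`τ_int(f) ≤ M/Z − 1/2` for centred bounded `f`),
  `indepMH_abs_acf_le_of_smul` (`|ρ_t| ≤ (1 − Z/M)ᵗ`), **`indepMH_window_bracket_of_smul`**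
  (`τ_W(2m) ≤ τ_int ≤ τ_W(2m) + (M/Z − 1)·ρ(2m)`).

Used by `Scoring/PathIMHAutocorrelation.lean` (the Metropolized non-equilibrium sampler of a Crooks
pair, `w = e^{−W}`, `Z = Z₁/Z₀`).  NOT CLAIMED: any number of ours; unbounded observables.
-/

noncomputable section

namespace Summit.Ventures.LatticeQCDFlow.Scoring

open MeasureTheory ProbabilityTheory Filter Set Summit.Ventures.LatticeQCDFlow.Exactness
open scoped ENNReal

/-! ### §1 Independence Metropolis with an un-normalised weight -/

section Unnormalised

variable {Ω : Type*} [MeasurableSpace Ω]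

omit [MeasurableSpace Ω] in
/-- The acceptance density is invariant under `w ↦ c w`, `c > 0` (row 2's `imhAccept_const_mul`). -/
theorem imhAcceptE_const_mul {w : Ω → ℝ} {c : ℝ} (hc : 0 < c) :
    imhAcceptE (fun x => c * w x) = imhAcceptE w := by
  funext x y
  unfold imhAcceptE
  rw [imhAccept_const_mul hc]

/-- … and so is the acceptance mass `A(x) = ∫ a(x, y) q(dy)` (the kernel itself: row 2's
`Exactness.indepMH_const_mul`). -/
theorem imhAcceptMass_const_mul (q : Measure Ω) {w : Ω → ℝ} {c : ℝ} (hc : 0 < c) :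
    imhAcceptMass q (fun x => c * w x) = imhAcceptMass q w := by
  funext x
  unfold imhAcceptMass
  rw [imhAcceptE_const_mul hc]

variable {q : Measure Ω} [IsProbabilityMeasure q] {w : Ω → ℝ} {Z : ℝ≥0∞} {π : Measure Ω}
  [IsProbabilityMeasure π]

omit [IsProbabilityMeasure q] in
/-- A positive measurable weight with `w · q = Z • π`, `Z < ∞`, is `q`-integrable. -/
theorem integrable_weight_of_smul (hw : Measurable w) (hw0 : ∀ x, 0 < w x) (hZtop : Z ≠ ⊤)
    (hπ : (q.withDensity fun x => ENNReal.ofReal (w x)) = Z • π) : Integrable w q := by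
  refine ⟨hw.aestronglyMeasurable, (hasFiniteIntegral_iff_ofReal (ae_of_all _ fun x => (hw0 x).le)).2 ?_⟩
  have h : ∫⁻ x, ENNReal.ofReal (w x) ∂q = Z := by
    rw [← setLIntegral_univ, ← withDensity_apply _ MeasurableSet.univ, hπ, Measure.smul_apply,
      measure_univ, smul_eq_mul, mul_one]
  rw [h]
  exact hZtop.lt_top

/-- **The normalised weight.**  If `w · q = Z • π` with `π` a probability law and `0 < Z < ∞`, then
`w̄ = Z⁻¹ w` is measurable, positive, integrable, has `w̄ · q = π`, and defines the SAME kernel: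
`indepMH q w = indepMH q w̄`. -/
theorem normalisedWeight_spec (hw : Measurable w) (hw0 : ∀ x, 0 < w x) (hZ0 : Z ≠ 0)
    (hZtop : Z ≠ ⊤) (hπ : (q.withDensity fun x => ENNReal.ofReal (w x)) = Z • π) :
    Measurable (fun x => Z.toReal⁻¹ * w x) ∧ (∀ x, 0 < Z.toReal⁻¹ * w x) ∧
      Integrable (fun x => Z.toReal⁻¹ * w x) q ∧
      (q.withDensity fun x => ENNReal.ofReal (Z.toReal⁻¹ * w x)) = π ∧
      indepMH q w = indepMH q (fun x => Z.toReal⁻¹ * w x) := by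
  have hZr : 0 < Z.toReal := ENNReal.toReal_pos hZ0 hZtop
  have hc : 0 < Z.toReal⁻¹ := inv_pos.2 hZr
  refine ⟨measurable_const.mul hw, fun x => mul_pos hc (hw0 x),
    (integrable_weight_of_smul hw hw0 hZtop hπ).const_mul _, ?_, (indepMH_const_mul q hc).symm⟩
  have hfun : (fun x => ENNReal.ofReal (Z.toReal⁻¹ * w x))
      = Z⁻¹ • fun x => ENNReal.ofReal (w x) := by
    funext x
    rw [Pi.smul_apply, smul_eq_mul, ENNReal.ofReal_mul hc.le, ENNReal.ofReal_inv_of_pos hZr,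
      ENNReal.ofReal_toReal hZtop]
  rw [hfun, withDensity_smul' _ _ (ENNReal.inv_ne_top.2 hZ0), hπ, smul_smul,
    ENNReal.inv_mul_cancel hZ0 hZtop, one_smul]

/-- **`π` is invariant** under `indepMH q w` whenever `w · q = Z • π` (`0 < Z < ∞`). -/
theorem indepMH_invariant_of_smul (hw : Measurable w) (hw0 : ∀ x, 0 < w x) (hZ0 : Z ≠ 0)
    (hZtop : Z ≠ ⊤) (hπ : (q.withDensity fun x => ENNReal.ofReal (w x)) = Z • π) :
    Kernel.Invariant (indepMH q w) π := by
  obtain ⟨h1, h2, -, h4, h5⟩ := normalisedWeight_spec hw hw0 hZ0 hZtop hπ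
  rw [h5, ← h4]
  exact indepMH_invariant h1 h2

/-- … indeed `indepMH q w` is `π`-REVERSIBLE. -/
theorem indepMH_isReversible_of_smul (hw : Measurable w) (hw0 : ∀ x, 0 < w x) (hZ0 : Z ≠ 0)
    (hZtop : Z ≠ ⊤) (hπ : (q.withDensity fun x => ENNReal.ofReal (w x)) = Z • π) :
    Kernel.IsReversible (indepMH q w) π := by
  obtain ⟨h1, h2, -, h4, h5⟩ := normalisedWeight_spec hw hw0 hZ0 hZtop hπ
  rw [h5, ← h4]
  exact indepMH_isReversible h1 h2

/-- **Every stationary autocovariance of every bounded measurable observable is `≥ 0`.** -/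
theorem indepMH_autocov_nonneg_of_smul (hw : Measurable w) (hw0 : ∀ x, 0 < w x) (hZ0 : Z ≠ 0)
    (hZtop : Z ≠ ⊤) (hπ : (q.withDensity fun x => ENNReal.ofReal (w x)) = Z • π)
    {g : Ω → ℝ} (hg : Measurable g) {C : ℝ} (hC : ∀ x, |g x| ≤ C) (t : ℕ) :
    0 ≤ autocov (indepMH q w) π g t := by
  obtain ⟨h1, h2, h3, h4, h5⟩ := normalisedWeight_spec hw hw0 hZ0 hZtop hπ
  rw [h5]
  exact indepMH_autocov_nonneg h1 h2 h3 h4 hg hC t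

/-- **`ρ₁ᵗ ≤ ρ_t`** for every bounded measurable observable. -/
theorem indepMH_acf_pow_le_of_smul (hw : Measurable w) (hw0 : ∀ x, 0 < w x) (hZ0 : Z ≠ 0)
    (hZtop : Z ≠ ⊤) (hπ : (q.withDensity fun x => ENNReal.ofReal (w x)) = Z • π)
    {g : Ω → ℝ} (hg : Measurable g) {C : ℝ} (hC : ∀ x, |g x| ≤ C) (t : ℕ) :
    (autocov (indepMH q w) π g 1 / autocov (indepMH q w) π g 0) ^ (t + 1)
      ≤ autocov (indepMH q w) π g (t + 1) / autocov (indepMH q w) π g 0 := by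
  obtain ⟨h1, h2, h3, h4, h5⟩ := normalisedWeight_spec hw hw0 hZ0 hZtop hπ
  rw [h5]
  exact indepMH_acf_pow_le h1 h2 h3 h4 hg hC t

/-- **The `τ_int` floor `(1 + ρ₁)/(2(1 − ρ₁)) ≤ τ_int`** (with `ρ₁ < 1`) for every bounded measurable
observable with a summable autocorrelation. -/
theorem indepMH_tauInt_floor_of_smul (hw : Measurable w) (hw0 : ∀ x, 0 < w x) (hZ0 : Z ≠ 0)
    (hZtop : Z ≠ ⊤) (hπ : (q.withDensity fun x => ENNReal.ofReal (w x)) = Z • π)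
    {g : Ω → ℝ} (hg : Measurable g) {C : ℝ} (hC : ∀ x, |g x| ≤ C)
    (hs : Summable fun t => autocov (indepMH q w) π g (t + 1) / autocov (indepMH q w) π g 0) :
    autocov (indepMH q w) π g 1 / autocov (indepMH q w) π g 0 < 1 ∧
      (1 + autocov (indepMH q w) π g 1 / autocov (indepMH q w) π g 0)
          / (2 * (1 - autocov (indepMH q w) π g 1 / autocov (indepMH q w) π g 0))
        ≤ tauInt (fun t => autocov (indepMH q w) π g t / autocov (indepMH q w) π g 0) := by
  obtain ⟨h1, h2, h3, h4, h5⟩ := normalisedWeight_spec hw hw0 hZ0 hZtop hπ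
  rw [h5] at hs ⊢
  exact indepMH_tauInt_floor h1 h2 h3 h4 hg hC hs

/-- **The rejection floor `τ_int ≥ 1/2 + r_g/(1 − r_g)`**, `r_g = ∫ g²(1 − A) dπ / ∫ g² dπ` with
`A = imhAcceptMass q w` the acceptance mass (itself independent of the normalisation of `w`). -/
theorem indepMH_tauInt_ge_rejection_of_smul (hw : Measurable w) (hw0 : ∀ x, 0 < w x) (hZ0 : Z ≠ 0)
    (hZtop : Z ≠ ⊤) (hπ : (q.withDensity fun x => ENNReal.ofReal (w x)) = Z • π)
    {g : Ω → ℝ} (hg : Measurable g) {C : ℝ} (hC : ∀ x, |g x| ≤ C)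
    (hs : Summable fun t => autocov (indepMH q w) π g (t + 1) / autocov (indepMH q w) π g 0) :
    (1 + (∫ x, g x ^ 2 * (1 - (imhAcceptMass q w x).toReal) ∂π) / autocov (indepMH q w) π g 0)
        / (2 * (1 - (∫ x, g x ^ 2 * (1 - (imhAcceptMass q w x).toReal) ∂π)
          / autocov (indepMH q w) π g 0))
      ≤ tauInt (fun t => autocov (indepMH q w) π g t / autocov (indepMH q w) π g 0) := by
  obtain ⟨h1, h2, h3, h4, h5⟩ := normalisedWeight_spec hw hw0 hZ0 hZtop hπ
  have hZr : 0 < Z.toReal := ENNReal.toReal_pos hZ0 hZtop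
  rw [← imhAcceptMass_const_mul q (inv_pos.2 hZr) (w := w)]
  rw [h5] at hs ⊢
  exact indepMH_tauInt_ge_rejection h1 h2 h3 h4 hg hC hs

omit [IsProbabilityMeasure π] in
/-- **A weight ceiling is a Doeblin constant**: `w ≤ M` and `w · q = Z • π` give
`indepMH q w (x, ·) ≥ (Z/M) · π` from every state — `Z/M = 1/w̄⋆` with `w̄⋆` the supremum of the
NORMALISED weight. -/
theorem indepMH_doeblin_of_smul (hw : Measurable w) (hw0 : ∀ x, 0 < w x) {M : ℝ}
    (hM : ∀ x, w x ≤ M) (hπ : (q.withDensity fun x => ENNReal.ofReal (w x)) = Z • π) :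
    ∀ x {B : Set Ω}, MeasurableSet B → Z / ENNReal.ofReal M * π B ≤ indepMH q w x B := by
  intro x B hB
  have h := indepMH_apply_ge (q := q) hw hw0 hM x hB
  rw [hπ, Measure.smul_apply, smul_eq_mul, ← mul_assoc] at h
  rwa [ENNReal.div_eq_inv_mul]

omit [MeasurableSpace Ω] in
/-- Bookkeeping: with `ε = Z / ofReal M` (`0 < M`, `Z ≠ 0`): `0 < ε` and
`1 / ε.toReal = M / Z.toReal`. -/
theorem doeblinConst_of_smul_spec {M : ℝ} (hMpos : 0 < M) (hZ0 : Z ≠ 0) :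
    0 < Z / ENNReal.ofReal M ∧ 1 / (Z / ENNReal.ofReal M).toReal = M / Z.toReal := by
  refine ⟨ENNReal.div_pos hZ0 ENNReal.ofReal_ne_top, ?_⟩
  rw [ENNReal.toReal_div, ENNReal.toReal_ofReal hMpos.le, one_div, inv_div]

/-- **`τ_int(f) ≤ M/Z − 1/2`** for every bounded measurable `π`-centred observable, under the weight
ceiling `w ≤ M` (`w · q = Z • π`, `0 < Z < ∞`). -/
theorem indepMH_tauInt_le_of_smul (hw : Measurable w) (hw0 : ∀ x, 0 < w x) {M : ℝ}
    (hM : ∀ x, w x ≤ M) (hZ0 : Z ≠ 0) (hZtop : Z ≠ ⊤)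
    (hπ : (q.withDensity fun x => ENNReal.ofReal (w x)) = Z • π)
    {f : Ω → ℝ} (hf : Measurable f) {C : ℝ} (hC : ∀ x, |f x| ≤ C) (hf0 : ∫ x, f x ∂π = 0) :
    tauInt (fun t => autocov (indepMH q w) π f t / autocov (indepMH q w) π f 0)
      ≤ M / Z.toReal - 1 / 2 := by
  haveI : Fact (Measurable w) := ⟨hw⟩
  obtain ⟨x⟩ := nonempty_of_isProbabilityMeasure π
  obtain ⟨hε0, hε⟩ := doeblinConst_of_smul_spec (Z := Z) ((hw0 x).trans_le (hM x)) hZ0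
  have h := tauInt_le_of_doeblin (indepMH_invariant_of_smul hw hw0 hZ0 hZtop hπ)
    (indepMH_doeblin_of_smul hw hw0 hM hπ) hε0 hf hC hf0
  rwa [hε] at h

/-- **`|ρ_f(t)| ≤ (1 − Z/M)ᵗ`** under the same hypotheses. -/
theorem indepMH_abs_acf_le_of_smul (hw : Measurable w) (hw0 : ∀ x, 0 < w x) {M : ℝ}
    (hM : ∀ x, w x ≤ M) (hZ0 : Z ≠ 0) (hZtop : Z ≠ ⊤)
    (hπ : (q.withDensity fun x => ENNReal.ofReal (w x)) = Z • π)
    {f : Ω → ℝ} (hf : Measurable f) {C : ℝ} (hC : ∀ x, |f x| ≤ C) (hf0 : ∫ x, f x ∂π = 0)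
    (t : ℕ) :
    |autocov (indepMH q w) π f t / autocov (indepMH q w) π f 0| ≤ (1 - Z.toReal / M) ^ t := by
  haveI : Fact (Measurable w) := ⟨hw⟩
  obtain ⟨x⟩ := nonempty_of_isProbabilityMeasure π
  have hMpos : 0 < M := (hw0 x).trans_le (hM x)
  have h := abs_acf_le_of_doeblin (indepMH_invariant_of_smul hw hw0 hZ0 hZtop hπ)
    (indepMH_doeblin_of_smul hw hw0 hM hπ) hf hC hf0 t
  rwa [ENNReal.toReal_div, ENNReal.toReal_ofReal hMpos.le] at h

/-- **Two-sided window bracket** `τ_W(2m) ≤ τ_int ≤ τ_W(2m) + (M/Z − 1)·ρ(2m)` under the same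
hypotheses. -/
theorem indepMH_window_bracket_of_smul (hw : Measurable w) (hw0 : ∀ x, 0 < w x) {M : ℝ}
    (hM : ∀ x, w x ≤ M) (hZ0 : Z ≠ 0) (hZtop : Z ≠ ⊤)
    (hπ : (q.withDensity fun x => ENNReal.ofReal (w x)) = Z • π)
    {f : Ω → ℝ} (hf : Measurable f) {C : ℝ} (hC : ∀ x, |f x| ≤ C) (hf0 : ∫ x, f x ∂π = 0)
    (m : ℕ) :
    tauIntWindow (fun t => autocov (indepMH q w) π f t / autocov (indepMH q w) π f 0) (2 * m)
        ≤ tauInt (fun t => autocov (indepMH q w) π f t / autocov (indepMH q w) π f 0) ∧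
      tauInt (fun t => autocov (indepMH q w) π f t / autocov (indepMH q w) π f 0)
        ≤ tauIntWindow (fun t => autocov (indepMH q w) π f t / autocov (indepMH q w) π f 0) (2 * m)
          + (M / Z.toReal - 1) * (autocov (indepMH q w) π f (2 * m) / autocov (indepMH q w) π f 0) := by
  obtain ⟨x⟩ := nonempty_of_isProbabilityMeasure π
  obtain ⟨hε0, hε⟩ := doeblinConst_of_smul_spec (Z := Z) ((hw0 x).trans_le (hM x)) hZ0
  have hmin := indepMH_doeblin_of_smul hw hw0 hM hπ
  obtain ⟨h1, h2, h3, h4, h5⟩ := normalisedWeight_spec hw hw0 hZ0 hZtop hπ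
  rw [h5] at hmin ⊢
  have h := indepMH_window_bracket_even h1 h2 h3 h4 hmin hε0 hf hC hf0 m
  rwa [hε] at h

end Unnormalised

end Summit.Ventures.LatticeQCDFlow.Scoring

end
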